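import Summits.HodgeConjecture.CorCM.Census.NondegenerateSplitting
import Summits.HodgeConjecture.CorCM.Census.BaseBlockNearTypes

/-!
# Cover closure: `μ(G, c) = φ₂(G, c)` for a `2`-group from a lowering cover of an ARBITRARY (possibly degenerate) base type

COR-CM (cell `pub-hodgecm2`), count-neutral kernel combinatorics by the binder seat b09 (gen 45; lane SQUARE-CENTRAL CLASS, part 0 — the
model-free meta-theorem the lane needs), on top of gen 38ʼs `Census/TwoAdicSplitting.lean` (`Splitting.isLeast_card_gfaces_generate_of_isPGroup`,
`Splitting.fibreIndep_of_parityIndep`), `Census/BaseBlockCovering.lean` (`bpot`, `exists_choice`, `bpot_corners_lt`, `par_cover_self/other`) and gen 32ʼs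
`Census/TwistGenerationDescent.lean` (`descent`, `single_sub_thetaG_mem_of`), all BY NAME.  Theorems only: no definition, no `decide`, no certificate, no
named fact, no `sorry`.  HONEST FRAMING: `HC_CM` is NOT proved, here or anywhere in the tree; nothing here is a period or a headline.

THE SETTING of `Census/CoinvariantFibre.lean`: `G` finite, `c` a central involution `≠ 1`, abstract CM types `CMF G c`, base change `rt c Q` (`Ψ ↦ Ψ·Q⁻¹`),
faces `gfaceSet`, pairs `pairSet`, the Hodge lattice `hodgeSpan`, the coinvariant fibre `φ₂(G,c) = fibreTwo`, the census number `μ(G,c)` = the least number of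
faces whose base changes together with the pairs generate `hodgeSpan`; `μ ≥ φ₂` always.  For a base type `T₀` the base-block potential `bpot T₀ Ψ` is the
Hamming distance from `Ψ` to the nearest base change of `T₀`; the RESIDUAL types are those of potential `≤ 1`.

WHY.  Gen 38ʼs meta-theorem `Splitting.isLeast_card_gfaces_generate_of_residual_reduction` closes a `2`-group row from a cover plus closing faces PROVIDED the
base type `T₀` is Kubota-nondegenerate and every residual type reduces ONTO the base changes of `T₀` up to a power of `2`.  In the world `c ∈ [G,G]` the
natural base blocks are small and stabilised — e.g. for `D₄ × E` (`E` elementary abelian, `c = (r², 0)`) the affine base block has FOUR types and every one of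
them is degenerate — so that meta-theorem is void exactly where the numerics of this lane say the cover alone already generates up to a `2`-power
(`D₄ × ℤ/2`: index `2`; `D₄ × ℤ/2²`: index `4`; Pauli: `64`; Pauli `× ℤ/2`: `8`; `2^{1+4}_±`: `8`, `128`).  This file supplies the degenerate version.

* §1 `psp_le_hodgeSpan`: `ℤ⟨pairs⟩ + ℤ⟨base changes of S⟩ ≤ hodgeSpan` for `S ⊆ gfaceSet`.
* §2 **RESIDUAL CLOSURE ⟹ `2`-POWER GENERATION** (`two_pow_smul_mem_of_residual`, any `G`): if every vector reduces modulo `L ≤ hodgeSpan` to one supported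
  on a residual class `Res`, and every HODGE vector supported on `Res` lies in `L` up to `2^k`, then `2^k · hodgeSpan ⊆ L`; the Hodge vectors supported on
  `Res` are exactly the residual vectors of constant type sum (`two_pow_smul_mem_of_residual_typeSum`).
* §3 **THE META-THEOREM** (`isLeast_card_gfaces_generate_of_residual_closure`, `2`-group): a fibre-independent (e.g. parity-independent, `…_of_parityIndep`)
  face family `S` with these two properties for `L = ℤ⟨pairs⟩ + ℤ⟨base changes of S⟩` has `μ(G,c) = φ₂(G,c)` — NO nondegeneracy of `T₀`, no reduction onto
  base changes.
* §4 **THE LOWERING COVER** (`exists_lowering_cover`): gen 38ʼs covering family of `T₀` with the property its proof uses but does not export — through EVERY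
  type `Ψ` of potential `≥ 2` the base changes of the cover contain a face `gface Ψ s s'` at two distinct deviation places toward a NEAREST base change of
  `T₀` (its three corners have smaller potential); plus parity independence, one member per far block, and the potential descent.
* §5 **THE COVER-CLOSURE LAW** (`isLeast_card_gfaces_generate_of_cover_closure`): for a `2`-group, if for EVERY lowering cover `S` of `T₀` every residual
  Hodge vector lies in `ℤ⟨pairs⟩ + ℤ⟨base changes of S⟩` up to `2^k`, then `μ(G,c) = φ₂(G,c)`.  This is the socket of the lane: a row is closed by
  analysing the residual lattice of ANY lowering cover, with no choice of cover to control.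
* §6 **LOWERING FACES FROM STAR NORMAL FORMS** (`gface_mem_of_star`, `gface_mem_of_class`): if a type and the three corners of a face at two of its deviation
  places (relative to a type `T`) all have gen 32ʼs star normal form modulo `L`, the face lies in `L`; with `single_sub_thetaG_mem_of`, ONE supplied face per
  type of a corner-closed class puts EVERY deviation face of the class into `L` — the tool that turns the single cover face at a stabilised tie type into
  all its lowering faces.

## References
* [Pohlmann1968] H. Pohlmann, Algebraic cycles on abelian varieties of complex multiplication type, Ann. of Math. 88 (1968), Thm 1.
* [Milne1999] J. S. Milne, Lefschetz motives and the Tate conjecture, Compositio Math. 117 (1999), Prop. 2.1, p. 54.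
-/

namespace Summit.HodgeConjecture.CorCM.Census.CoverClosure

open Finset
open Summit.HodgeConjecture.CorCM.Prior.AllgGroup.RfwfAllgGroup
open Summit.HodgeConjecture.CorCM.Census.BlockParity
open Summit.HodgeConjecture.CorCM.Census.Coinvariant
open Summit.HodgeConjecture.CorCM.Census.TwistGeneration
open Summit.HodgeConjecture.CorCM.Census.BaseBlock
open Summit.HodgeConjecture.CorCM.Census.Splitting

noncomputable section

variable {G : Type*} [Group G] [Fintype G] [DecidableEq G] (c : G)

/-! ## §1 Pairs and base changes of faces are Hodge vectors -/

/-- `ℤ⟨pairs⟩ + ℤ⟨base changes of S⟩ ≤ hodgeSpan` for a face family `S`. [folklore] -/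
theorem psp_le_hodgeSpan (hc2 : c * c = 1) (S : Finset (CMF G c →₀ ℤ)) (hS : (↑S : Set (CMF G c →₀ ℤ)) ⊆ gfaceSet G c hc2) :
    Submodule.span ℤ (pairSet c) ⊔ Submodule.span ℤ (translates c S) ≤ hodgeSpan c hc2 := by
  refine sup_le (Submodule.span_le.mpr ?_) (Submodule.span_le.mpr ?_)
  · rintro _ ⟨Ψ, rfl⟩
    exact pair_mem_hodgeSpan c hc2 Ψ
  · rintro _ ⟨Q, s, hs, rfl⟩
    exact Submodule.mem_sup_left (mapDomain_rt_mem_span_gfaceSet c hc2 Q (Submodule.subset_span (hS (mem_coe.mpr hs))))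

/-! ## §2 Residual closure implies `2`-power generation -/

/-- **RESIDUAL CLOSURE ⟹ `2`-POWER GENERATION** (any finite `G`).  If every vector is congruent modulo `L ≤ hodgeSpan` to one supported on the class
`Res`, and every Hodge vector supported on `Res` lies in `L` up to `2^k`, then `2^k · hodgeSpan ⊆ L`. [folklore] -/
theorem two_pow_smul_mem_of_residual (hc2 : c * c = 1) {L : Submodule ℤ (CMF G c →₀ ℤ)} (hLH : L ≤ hodgeSpan c hc2)
    (Res : CMF G c → Prop) (k : ℕ)
    (hdesc : ∀ y : CMF G c →₀ ℤ, ∃ y' : CMF G c →₀ ℤ, y - y' ∈ L ∧ ∀ Ψ ∈ y'.support, Res Ψ)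
    (hres : ∀ y ∈ hodgeSpan c hc2, (∀ Ψ ∈ y.support, Res Ψ) → ((2 : ℤ) ^ k) • y ∈ L) :
    ∀ y ∈ hodgeSpan c hc2, ((2 : ℤ) ^ k) • y ∈ L := by
  intro y hy
  obtain ⟨y', hyy', hy'⟩ := hdesc y
  have hy'H : y' ∈ hodgeSpan c hc2 := by
    have e : y' = y - (y - y') := by abel
    rw [e]
    exact Submodule.sub_mem _ hy (hLH hyy')
  have e : ((2 : ℤ) ^ k) • y = ((2 : ℤ) ^ k) • (y - y') + ((2 : ℤ) ^ k) • y' := by rw [← smul_add]; abel_nf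
  rw [e]
  exact Submodule.add_mem _ (Submodule.smul_mem _ _ hyy') (hres y' hy'H hy')

/-- **The residual Hodge vectors are the residual vectors of constant type sum** (central `c ≠ 1`): the closure hypothesis of
`two_pow_smul_mem_of_residual` in the form a lane verifies it. [folklore] -/
theorem two_pow_smul_mem_of_residual_typeSum (hc2 : c * c = 1) (hc1 : c ≠ 1) (hcen : ∀ x : G, x * c = c * x)
    {L : Submodule ℤ (CMF G c →₀ ℤ)} (hLH : L ≤ hodgeSpan c hc2) (Res : CMF G c → Prop) (k : ℕ)
    (hdesc : ∀ y : CMF G c →₀ ℤ, ∃ y' : CMF G c →₀ ℤ, y - y' ∈ L ∧ ∀ Ψ ∈ y'.support, Res Ψ)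
    (hres : ∀ y : CMF G c →₀ ℤ, (∀ Ψ ∈ y.support, Res Ψ) → ∀ m : ℤ, (∀ x : G, typeSum G c y x = m) → ((2 : ℤ) ^ k) • y ∈ L) :
    ∀ y ∈ hodgeSpan c hc2, ((2 : ℤ) ^ k) • y ∈ L := by
  refine two_pow_smul_mem_of_residual c hc2 hLH Res k hdesc fun y hy hyR => ?_
  obtain ⟨m, hm⟩ := (mem_hodgeSpan_iff c hc2 hc1 hcen y).mp hy
  exact hres y hyR m hm

/-! ## §3 The meta-theorem: residual closure for a `2`-group -/

/-- **META-THEOREM (degenerate base types allowed).**  `2`-group, `S ⊆ gfaceSet` FIBRE-INDEPENDENT, every vector congruent modulo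
`L = ℤ⟨pairs⟩ + ℤ⟨base changes of S⟩` to one supported on `Res`, every Hodge vector supported on `Res` in `L` up to `2^k` ⟹ **`μ(G,c) = φ₂(G,c)`**. [folklore] -/
theorem isLeast_card_gfaces_generate_of_residual_closure (hG : IsPGroup 2 G) (hc2 : c * c = 1) (hc1 : c ≠ 1)
    (hcen : ∀ x : G, x * c = c * x) (S : Finset (CMF G c →₀ ℤ)) (hS : (↑S : Set (CMF G c →₀ ℤ)) ⊆ gfaceSet G c hc2)
    (hli : LinearIndepOn (ZMod 2) (fun f : CMF G c →₀ ℤ => (rad2 c hc2).mkQ (red c f)) ↑S) (Res : CMF G c → Prop) (k : ℕ)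
    (hdesc : ∀ y : CMF G c →₀ ℤ, ∃ y' : CMF G c →₀ ℤ,
      y - y' ∈ Submodule.span ℤ (pairSet c) ⊔ Submodule.span ℤ (translates c S) ∧ ∀ Ψ ∈ y'.support, Res Ψ)
    (hres : ∀ y ∈ hodgeSpan c hc2, (∀ Ψ ∈ y.support, Res Ψ) →
      ((2 : ℤ) ^ k) • y ∈ Submodule.span ℤ (pairSet c) ⊔ Submodule.span ℤ (translates c S)) :
    IsLeast {n : ℕ | ∃ S : Finset (CMF G c →₀ ℤ), (↑S ⊆ gfaceSet G c hc2) ∧ S.card = n ∧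
      hodgeSpan c hc2 ≤ Submodule.span ℤ (pairSet c) ⊔ Submodule.span ℤ (translates c S)} (fibreTwo c hc2) :=
  isLeast_card_gfaces_generate_of_isPGroup c hG hc2 hc1 hcen S hS hli k
    (two_pow_smul_mem_of_residual c hc2 (psp_le_hodgeSpan c hc2 S hS) Res k hdesc hres)

/-- **META-THEOREM, parity form**: the same with `S` PARITY-independent (every covering family is, by the pivot criterion). [folklore] -/
theorem isLeast_card_gfaces_generate_of_residual_closure_par (hG : IsPGroup 2 G) (hc2 : c * c = 1) (hc1 : c ≠ 1)
    (hcen : ∀ x : G, x * c = c * x) (S : Finset (CMF G c →₀ ℤ)) (hS : (↑S : Set (CMF G c →₀ ℤ)) ⊆ gfaceSet G c hc2)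
    (hli : LinearIndepOn (ZMod 2) (fun f : CMF G c →₀ ℤ => par c f) ↑S) (Res : CMF G c → Prop) (k : ℕ)
    (hdesc : ∀ y : CMF G c →₀ ℤ, ∃ y' : CMF G c →₀ ℤ,
      y - y' ∈ Submodule.span ℤ (pairSet c) ⊔ Submodule.span ℤ (translates c S) ∧ ∀ Ψ ∈ y'.support, Res Ψ)
    (hres : ∀ y ∈ hodgeSpan c hc2, (∀ Ψ ∈ y.support, Res Ψ) →
      ((2 : ℤ) ^ k) • y ∈ Submodule.span ℤ (pairSet c) ⊔ Submodule.span ℤ (translates c S)) :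
    IsLeast {n : ℕ | ∃ S : Finset (CMF G c →₀ ℤ), (↑S ⊆ gfaceSet G c hc2) ∧ S.card = n ∧
      hodgeSpan c hc2 ≤ Submodule.span ℤ (pairSet c) ⊔ Submodule.span ℤ (translates c S)} (fibreTwo c hc2) :=
  isLeast_card_gfaces_generate_of_residual_closure c hG hc2 hc1 hcen S hS (fibreIndep_of_parityIndep c hc2 _ hli) Res k hdesc hres

/-! ## §4 The lowering cover of a base type -/

/-- **THE LOWERING COVER** of the base type `T₀` (gen 38ʼs `BaseBlock.exists_cover` with the lowering property exported).  A face family `S ⊆ gfaceSet` with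
EXACTLY one member per block of potential `≥ 2`, PARITY-independent, such that through EVERY type `Ψ` of potential `≥ 2` the base changes of `S` contain a
face `gface Ψ s s'` at two distinct deviation places `s ≠ s'` toward a nearest base change `T₀·Q⁻¹` of `T₀` (`bpot Ψ = ddist (T₀·Q⁻¹) Ψ`), and every vector
is congruent, modulo any lattice containing the base changes of `S`, to one supported on the residual types. [folklore] -/
theorem exists_lowering_cover (hc2 : c * c = 1) (T₀ : CMF G c) :
    ∃ S : Finset (CMF G c →₀ ℤ), (↑S ⊆ gfaceSet G c hc2) ∧
      S.card = (univ.filter fun Bk : Block c => 2 ≤ bpot c T₀ Bk.out).card ∧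
      LinearIndepOn (ZMod 2) (fun f : CMF G c →₀ ℤ => par c f) ↑S ∧
      (∀ Ψ : CMF G c, 2 ≤ bpot c T₀ Ψ → ∃ Q s s' : G, bpot c T₀ Ψ = ddist (rt c Q T₀) Ψ ∧
        s ∈ (rt c Q T₀).1 \ Ψ.1 ∧ s' ∈ (rt c Q T₀).1 \ Ψ.1 ∧ s ≠ s' ∧
        gface c hc2 Ψ s s' ∈ Submodule.span ℤ (translates c S)) ∧
      ∀ L : Submodule ℤ (CMF G c →₀ ℤ), Submodule.span ℤ (translates c S) ≤ L →
        ∀ y : CMF G c →₀ ℤ, ∃ y' : CMF G c →₀ ℤ, y - y' ∈ L ∧ ∀ Ψ ∈ y'.support, bpot c T₀ Ψ ≤ 1 := by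
  classical
  -- the choice at every block representative of potential `≥ 2` (as in `BaseBlock.exists_cover`)
  have hch : ∀ Bk : Block c, ∃ τ : G × G × G, 2 ≤ bpot c T₀ Bk.out →
      bpot c T₀ Bk.out = ddist (rt c τ.1 T₀) Bk.out ∧
        τ.2.1 ∈ (rt c τ.1 T₀).1 \ Bk.out.1 ∧ τ.2.2 ∈ (rt c τ.1 T₀).1 \ Bk.out.1 ∧ τ.2.1 ≠ τ.2.2 := by
    intro Bk
    by_cases h : 2 ≤ bpot c T₀ Bk.out
    · obtain ⟨Q, t, t', h1, h3, h4, h5⟩ := exists_choice c T₀ Bk.out h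
      exact ⟨(Q, t, t'), fun _ => ⟨h1, h3, h4, h5⟩⟩
    · exact ⟨(1, 1, 1), fun h' => absurd h' h⟩
  choose τ hτ using hch
  set NI : Finset (Block c) := univ.filter fun Bk : Block c => 2 ≤ bpot c T₀ Bk.out with hNI
  set face : Block c → (CMF G c →₀ ℤ) := fun Bk => gface c hc2 Bk.out (τ Bk).2.1 (τ Bk).2.2 with hfaceDef
  set S : Finset (CMF G c →₀ ℤ) := NI.image face with hS
  have hself : ∀ Bk ∈ NI, par c (face Bk) Bk = 1 := by
    intro Bk hBk
    obtain ⟨h1, h3, h4, h5⟩ := hτ Bk (mem_filter.mp hBk).2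
    have h := par_cover_self c T₀ hc2 h1 h3 h4 h5
    rwa [blk_out] at h
  have hother : ∀ Bk ∈ NI, ∀ B : Block c, B ≠ Bk → bpot c T₀ Bk.out ≤ bpot c T₀ B.out → par c (face Bk) B = 0 := by
    intro Bk hBk B hB hle
    obtain ⟨h1, h3, h4, h5⟩ := hτ Bk (mem_filter.mp hBk).2
    exact par_cover_other c T₀ hc2 h1 h3 h4 h5 (by rw [blk_out]; exact hB) hle
  have hinj : Set.InjOn face ↑NI := by
    intro B₁ hB₁ B₂ hB₂ heq
    by_contra hne
    rcases le_total (bpot c T₀ B₁.out) (bpot c T₀ B₂.out) with hle | hle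
    · have h0 := hother B₁ hB₁ B₂ (Ne.symm hne) hle
      rw [heq, hself B₂ hB₂] at h0
      exact one_ne_zero h0
    · have h0 := hother B₂ hB₂ B₁ hne hle
      rw [← heq, hself B₁ hB₁] at h0
      exact one_ne_zero h0
  have hSsub : (↑S : Set (CMF G c →₀ ℤ)) ⊆ gfaceSet G c hc2 := by
    intro y hy
    obtain ⟨Bk, hBk, rfl⟩ := mem_image.mp (mem_coe.mp hy)
    obtain ⟨-, h3, h4, h5⟩ := hτ Bk (mem_filter.mp hBk).2
    exact ⟨Bk.out, _, _, not_mem_orb_of_mem (mem_sdiff.mp h3).1 (mem_sdiff.mp h4).1 h5, rfl⟩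
  -- the lowering property: translate the block face to every type of the block
  have hlow : ∀ Ψ : CMF G c, 2 ≤ bpot c T₀ Ψ → ∃ Q s s' : G, bpot c T₀ Ψ = ddist (rt c Q T₀) Ψ ∧
      s ∈ (rt c Q T₀).1 \ Ψ.1 ∧ s' ∈ (rt c Q T₀).1 \ Ψ.1 ∧ s ≠ s' ∧
      gface c hc2 Ψ s s' ∈ Submodule.span ℤ (translates c S) := by
    intro Ψ hΨ2
    obtain ⟨Q, hQ⟩ := exists_rt_eq_of_blk_eq c (Quotient.out_eq (blk c Ψ) : blk c (blk c Ψ).out = blk c Ψ)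
    have hBNI : blk c Ψ ∈ NI := mem_filter.mpr ⟨mem_univ _, by rw [bpot_out]; exact hΨ2⟩
    obtain ⟨h1, h3, h4, h5⟩ := hτ (blk c Ψ) (mem_filter.mp hBNI).2
    set R := (τ (blk c Ψ)).1
    set t := (τ (blk c Ψ)).2.1
    set t' := (τ (blk c Ψ)).2.2
    refine ⟨Q * R, t * Q⁻¹, t' * Q⁻¹, ?_, ?_, ?_, fun h => h5 (mul_right_cancel h), ?_⟩
    · rw [← hQ, bpot_rt, rt_mul, ddist_rt]; exact h1
    · rw [rt_mul, ← hQ, mem_sdiff_rt_iff, inv_mul_cancel_right]; exact h3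
    · rw [rt_mul, ← hQ, mem_sdiff_rt_iff, inv_mul_cancel_right]; exact h4
    · have e : gface c hc2 Ψ (t * Q⁻¹) (t' * Q⁻¹) = Finsupp.mapDomain (rt c Q) (face (blk c Ψ)) := by
        rw [mapDomain_rt_gface, hQ]
      rw [e]
      exact Submodule.subset_span ⟨Q, _, mem_image_of_mem _ hBNI, rfl⟩
  refine ⟨S, hSsub, card_image_of_injOn hinj, ?_, hlow, fun L hL y => ?_⟩
  · -- parity independence by the pivot criterion (pivot = own block, rank = potential)
    set p : (CMF G c →₀ ℤ) → Block c := fun f => if h : ∃ Bk ∈ NI, face Bk = f then h.choose else blk c T₀ with hp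
    have hpf : ∀ Bk ∈ NI, p (face Bk) = Bk := by
      intro Bk hBk
      have h : ∃ B ∈ NI, face B = face Bk := ⟨Bk, hBk, rfl⟩
      rw [hp]; simp only [dif_pos h]
      exact hinj h.choose_spec.1 hBk h.choose_spec.2
    rw [LinearIndepOn, linearIndependent_iff']
    intro t g hsum i₁ hi₁
    by_contra hgi₁
    obtain ⟨i₀, hi₀, hmax⟩ := Finset.exists_max_image (t.filter fun i => g i ≠ 0) (fun i => bpot c T₀ (p i.1).out)
      ⟨i₁, mem_filter.mpr ⟨hi₁, hgi₁⟩⟩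
    obtain ⟨hi₀t, hgi₀⟩ := mem_filter.mp hi₀
    obtain ⟨B₀, hB₀, hfB₀⟩ := mem_image.mp i₀.2
    have hp₀ : p i₀.1 = B₀ := by rw [← hfB₀]; exact hpf B₀ hB₀
    have heval := congrFun hsum B₀
    rw [Finset.sum_apply, Pi.zero_apply, Finset.sum_eq_single_of_mem i₀ hi₀t] at heval
    · rw [Pi.smul_apply, smul_eq_mul, ← hfB₀, hself B₀ hB₀, mul_one] at heval
      exact hgi₀ heval
    · intro j hjt hji
      rw [Pi.smul_apply, smul_eq_mul]
      by_cases hgj : g j = 0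
      · rw [hgj, zero_mul]
      · obtain ⟨Bj, hBj, hfBj⟩ := mem_image.mp j.2
        have hpj : p j.1 = Bj := by rw [← hfBj]; exact hpf Bj hBj
        have hlj : bpot c T₀ Bj.out ≤ bpot c T₀ B₀.out := by
          have h := hmax j (mem_filter.mpr ⟨hjt, hgj⟩)
          rwa [hpj, hp₀] at h
        have hne : B₀ ≠ Bj := fun e => hji (Subtype.ext (by rw [← hfBj, ← hfB₀, e]))
        rw [← hfBj, hother Bj hBj B₀ hne hlj, mul_zero]
  · -- descent on the potential, fed by the lowering property
    refine descent c (bpot c T₀) (fun Ψ => bpot c T₀ Ψ ≤ 1) hc2 L (fun Ψ hΨ => ?_) y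
    obtain ⟨Q, s, s', hQ, hs, hs', hss', hmem⟩ := hlow Ψ (by omega)
    exact ⟨s, s', hL hmem, bpot_corners_lt c T₀ hc2 hQ hs hs' hss'⟩

/-! ## §5 The cover-closure law -/

/-- **THE COVER-CLOSURE LAW.**  `G` a `2`-group, `c` a central involution `≠ 1`, `T₀` ANY base type.  If for every lowering cover `S` of `T₀` (a face family
through whose base changes every type of potential `≥ 2` has a face at two distinct deviation places toward a nearest base change of `T₀`) every residual
Hodge vector lies in `ℤ⟨pairs⟩ + ℤ⟨base changes of S⟩` up to `2^k`, then **`μ(G,c) = φ₂(G,c)`**. [folklore] -/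
theorem isLeast_card_gfaces_generate_of_cover_closure (hG : IsPGroup 2 G) (hc2 : c * c = 1) (hc1 : c ≠ 1)
    (hcen : ∀ x : G, x * c = c * x) (T₀ : CMF G c) (k : ℕ)
    (hres : ∀ S : Finset (CMF G c →₀ ℤ), (↑S ⊆ gfaceSet G c hc2) →
      (∀ Ψ : CMF G c, 2 ≤ bpot c T₀ Ψ → ∃ Q s s' : G, bpot c T₀ Ψ = ddist (rt c Q T₀) Ψ ∧
        s ∈ (rt c Q T₀).1 \ Ψ.1 ∧ s' ∈ (rt c Q T₀).1 \ Ψ.1 ∧ s ≠ s' ∧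
        gface c hc2 Ψ s s' ∈ Submodule.span ℤ (translates c S)) →
      ∀ y ∈ hodgeSpan c hc2, (∀ Ψ ∈ y.support, bpot c T₀ Ψ ≤ 1) →
        ((2 : ℤ) ^ k) • y ∈ Submodule.span ℤ (pairSet c) ⊔ Submodule.span ℤ (translates c S)) :
    IsLeast {n : ℕ | ∃ S : Finset (CMF G c →₀ ℤ), (↑S ⊆ gfaceSet G c hc2) ∧ S.card = n ∧
      hodgeSpan c hc2 ≤ Submodule.span ℤ (pairSet c) ⊔ Submodule.span ℤ (translates c S)} (fibreTwo c hc2) := by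
  obtain ⟨S, hS, -, hli, hlow, hdesc⟩ := exists_lowering_cover c hc2 T₀
  refine isLeast_card_gfaces_generate_of_residual_closure_par c hG hc2 hc1 hcen S hS hli (fun Ψ => bpot c T₀ Ψ ≤ 1) k
    (fun y => hdesc _ le_sup_right y) (hres S hS hlow)

/-- **THE COVER-CLOSURE LAW, type-sum form**: it suffices that every vector supported on residual types WITH CONSTANT TYPE SUM lies in
`ℤ⟨pairs⟩ + ℤ⟨base changes of S⟩` up to `2^k`, for every lowering cover `S`. [folklore] -/
theorem isLeast_card_gfaces_generate_of_cover_closure_typeSum (hG : IsPGroup 2 G) (hc2 : c * c = 1) (hc1 : c ≠ 1)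
    (hcen : ∀ x : G, x * c = c * x) (T₀ : CMF G c) (k : ℕ)
    (hres : ∀ S : Finset (CMF G c →₀ ℤ), (↑S ⊆ gfaceSet G c hc2) →
      (∀ Ψ : CMF G c, 2 ≤ bpot c T₀ Ψ → ∃ Q s s' : G, bpot c T₀ Ψ = ddist (rt c Q T₀) Ψ ∧
        s ∈ (rt c Q T₀).1 \ Ψ.1 ∧ s' ∈ (rt c Q T₀).1 \ Ψ.1 ∧ s ≠ s' ∧
        gface c hc2 Ψ s s' ∈ Submodule.span ℤ (translates c S)) →
      ∀ y : CMF G c →₀ ℤ, (∀ Ψ ∈ y.support, bpot c T₀ Ψ ≤ 1) → ∀ m : ℤ, (∀ x : G, typeSum G c y x = m) →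
        ((2 : ℤ) ^ k) • y ∈ Submodule.span ℤ (pairSet c) ⊔ Submodule.span ℤ (translates c S)) :
    IsLeast {n : ℕ | ∃ S : Finset (CMF G c →₀ ℤ), (↑S ⊆ gfaceSet G c hc2) ∧ S.card = n ∧
      hodgeSpan c hc2 ≤ Submodule.span ℤ (pairSet c) ⊔ Submodule.span ℤ (translates c S)} (fibreTwo c hc2) := by
  refine isLeast_card_gfaces_generate_of_cover_closure c hG hc2 hc1 hcen T₀ k fun S hS hlow y hy hyR => ?_
  obtain ⟨m, hm⟩ := (mem_hodgeSpan_iff c hc2 hc1 hcen y).mp hy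
  exact hres S hS hlow y hyR m hm

/-! ## §6 Lowering faces from star normal forms -/

/-- **A face whose four corners have star normal forms lies in `L`.**  For a type `T` and a face `gface Φ s s'` at distinct places (`s' ∉ {s, c·s}`): if
`[X] − θ_T(typeSum [X]) ∈ L` for `X = Φ, Φ^{(s)}, Φ^{(s')}, Φ^{(s s')}`, then `gface Φ s s' ∈ L` — the type sum of a face vanishes and `θ_T` is linear.
[folklore] -/
theorem gface_mem_of_star (hc2 : c * c = 1) (L : Submodule ℤ (CMF G c →₀ ℤ)) (T Φ : CMF G c) {s s' : G} (hs' : s' ∉ orb c s)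
    (h0 : Finsupp.single Φ 1 - thetaG c hc2 T (typeSum G c (Finsupp.single Φ 1)) ∈ L)
    (h1 : Finsupp.single (oflipCM c hc2 s Φ) 1 - thetaG c hc2 T (typeSum G c (Finsupp.single (oflipCM c hc2 s Φ) 1)) ∈ L)
    (h2 : Finsupp.single (oflipCM c hc2 s' Φ) 1 - thetaG c hc2 T (typeSum G c (Finsupp.single (oflipCM c hc2 s' Φ) 1)) ∈ L)
    (h3 : Finsupp.single (oflipCM c hc2 s (oflipCM c hc2 s' Φ)) 1 -
      thetaG c hc2 T (typeSum G c (Finsupp.single (oflipCM c hc2 s (oflipCM c hc2 s' Φ)) 1)) ∈ L) :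
    gface c hc2 Φ s s' ∈ L := by
  have hts : thetaG c hc2 T (typeSum G c (gface c hc2 Φ s s')) = 0 := by
    rw [typeSum_gface c hc2 Φ hs', map_zero]
  have e : gface c hc2 Φ s s' =
      (Finsupp.single Φ 1 - thetaG c hc2 T (typeSum G c (Finsupp.single Φ 1))) +
      (Finsupp.single (oflipCM c hc2 s (oflipCM c hc2 s' Φ)) 1 -
        thetaG c hc2 T (typeSum G c (Finsupp.single (oflipCM c hc2 s (oflipCM c hc2 s' Φ)) 1))) -
      (Finsupp.single (oflipCM c hc2 s Φ) 1 - thetaG c hc2 T (typeSum G c (Finsupp.single (oflipCM c hc2 s Φ) 1))) -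
      (Finsupp.single (oflipCM c hc2 s' Φ) 1 - thetaG c hc2 T (typeSum G c (Finsupp.single (oflipCM c hc2 s' Φ) 1))) +
      thetaG c hc2 T (typeSum G c (gface c hc2 Φ s s')) := by
    simp only [gface, map_add, map_sub]
    abel
  rw [e, hts, add_zero]
  exact Submodule.sub_mem _ (Submodule.sub_mem _ (Submodule.add_mem _ h0 h3) h1) h2

/-- **ONE FACE PER TYPE GIVES EVERY DEVIATION FACE.**  In the setting of gen 32ʼs restricted star reduction (`single_sub_thetaG_mem_of`: `L` holds, through
every type of a class `U` deviating from `T` at `≥ 2` places, a face at two distinct deviation places whose three corners lie in `U`), EVERY face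
`gface Φ s s'` at two distinct deviation places `s, s' ∈ T ∖ Φ` of a type `Φ ∈ U` whose three corners lie in `U` is in `L`. [folklore] -/
theorem gface_mem_of_class (hc2 : c * c = 1) (L : Submodule ℤ (CMF G c →₀ ℤ)) (T : CMF G c) (U : CMF G c → Prop)
    (hL : ∀ Φ : CMF G c, U Φ → 2 ≤ (T.1 \ Φ.1).card → ∃ s s' : G, s ∈ T.1 \ Φ.1 ∧ s' ∈ T.1 \ Φ.1 ∧ s ≠ s' ∧
      gface c hc2 Φ s s' ∈ L ∧ U (oflipCM c hc2 s Φ) ∧ U (oflipCM c hc2 s' Φ) ∧ U (oflipCM c hc2 s (oflipCM c hc2 s' Φ)))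
    (Φ : CMF G c) (hΦ : U Φ) {s s' : G} (hs : s ∈ T.1 \ Φ.1) (hs' : s' ∈ T.1 \ Φ.1) (hss' : s ≠ s')
    (hU1 : U (oflipCM c hc2 s Φ)) (hU2 : U (oflipCM c hc2 s' Φ)) (hU3 : U (oflipCM c hc2 s (oflipCM c hc2 s' Φ))) :
    gface c hc2 Φ s s' ∈ L := by
  have star := single_sub_thetaG_mem_of c T U hc2 L hL
  exact gface_mem_of_star c hc2 L T Φ (not_mem_orb_of_mem (mem_sdiff.mp hs).1 (mem_sdiff.mp hs').1 hss')
    (star Φ hΦ) (star _ hU1) (star _ hU2) (star _ hU3)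

end

end Summit.HodgeConjecture.CorCM.Census.CoverClosure
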